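import Literature.Analysis.Matrix.GapAnchorVolume
import HarnessLib

/-!
# The differences map `a ↦ ((a_{J+1} - a_J)_{J<m}, a_m)` as a continuous linear equivalence of `ℝ^{m+1}`

Analysis/Matrix support file, sequel of `GapAnchorVolume`: the inverse of
`(t, g) ↦ gapAnchor (t, g)` (point times from anchor and consecutive gaps) is the **differences map**
`a ↦ (consecutive gaps (a_{J+1} - a_J)_J, anchor a_m)`, here packaged — after identifying
`ℝ × ℝᵐ` with `ℝ^{m+1}` by `Fin.snoc` — as a continuous linear equivalence `diffEquiv m` of
`ℝ^{m+1}` (`diffEquiv_apply_castSucc/last`, `diffEquiv_symm_apply`), so that Schwartz functions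
of (gaps, anchor) become Schwartz functions of the point times by
`SchwartzMap.compCLMOfContinuousLinearEquiv` (with the seminorm transfer of
`SchwartzCompEquivBound`). Used for the explicit regularisation weights of Osterwalder–Schrader II
(Comm. Math. Phys. 42 (1975)), Ch. VI.1.
-/

noncomputable section

namespace Literature.Analysis.Matrix

variable (m : ℕ)

/-- The differences map as a linear map: `(D a)_J = a_{J+1} - a_J` for `J < m`, `(D a)_m = a_m`. [folklore] -/
def diffLinear : (Fin (m + 1) → ℝ) →ₗ[ℝ] (Fin (m + 1) → ℝ) where
  toFun a := Fin.snoc (fun J : Fin m => a J.succ - a J.castSucc) (a (Fin.last m))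
  map_add' a b := by
    ext i
    refine Fin.lastCases ?_ (fun J => ?_) i
    · simp
    · simp only [Fin.snoc_castSucc, Pi.add_apply]; ring
  map_smul' c a := by
    ext i
    refine Fin.lastCases ?_ (fun J => ?_) i
    · simp
    · simp only [Fin.snoc_castSucc, Pi.smul_apply, smul_eq_mul, RingHom.id_apply]; ring

/-- Values: consecutive differences. [folklore] -/
@[simp] theorem diffLinear_apply_castSucc (a : Fin (m + 1) → ℝ) (J : Fin m) :
    diffLinear m a J.castSucc = a J.succ - a J.castSucc := by
  simp [diffLinear]

/-- Values: the anchor. [folklore] -/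
@[simp] theorem diffLinear_apply_last (a : Fin (m + 1) → ℝ) : diffLinear m a (Fin.last m) = a (Fin.last m) := by
  simp [diffLinear]

/-- The inverse: point times from (anchor, gaps), `gapAnchor`. [folklore] -/
def undiffLinear : (Fin (m + 1) → ℝ) →ₗ[ℝ] (Fin (m + 1) → ℝ) where
  toFun d := gapAnchor m (d (Fin.last m), fun J => d J.castSucc)
  map_add' d e := by
    ext i
    refine Fin.lastCases ?_ (fun J => ?_) i
    · simp [gapAnchor]
    · simp only [gapAnchor_castSucc, Pi.add_apply, suffixSum_apply, Finset.sum_add_distrib]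
      ring
  map_smul' c d := by
    ext i
    refine Fin.lastCases ?_ (fun J => ?_) i
    · simp [gapAnchor]
    · simp only [gapAnchor_castSucc, Pi.smul_apply, smul_eq_mul, RingHom.id_apply, suffixSum_apply]
      rw [mul_sub, Finset.mul_sum]

/-- Values of the inverse. [folklore] -/
theorem undiffLinear_apply (d : Fin (m + 1) → ℝ) :
    undiffLinear m d = gapAnchor m (d (Fin.last m), fun J => d J.castSucc) := rfl

/-- Removing the first element of a suffix: `∑_{a ≥ J} g_a = g_J + ∑_{a ≥ J+1} g_a` (as `Fin` filters). [folklore] -/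
theorem sum_filter_ge_eq_add (g : Fin m → ℝ) (J : Fin m) :
    ∑ a ∈ Finset.univ.filter (fun a : Fin m => J ≤ a), g a =
      g J + ∑ a ∈ Finset.univ.filter (fun a : Fin m => J.val + 1 ≤ a.val), g a := by
  have hsplit : Finset.univ.filter (fun a : Fin m => J ≤ a) =
      insert J (Finset.univ.filter (fun a : Fin m => J.val + 1 ≤ a.val)) := by
    ext a
    simp only [Finset.mem_filter, Finset.mem_univ, true_and, Finset.mem_insert, Fin.ext_iff]
    rw [Fin.le_iff_val_le_val]
    omega
  have hnotin : J ∉ Finset.univ.filter (fun a : Fin m => J.val + 1 ≤ a.val) := by simp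
  rw [hsplit, Finset.sum_insert hnotin]

/-- `diff ∘ undiff = id`. [folklore] -/
theorem diffLinear_undiffLinear (d : Fin (m + 1) → ℝ) : diffLinear m (undiffLinear m d) = d := by
  ext i
  refine Fin.lastCases ?_ (fun J => ?_) i
  · simp [undiffLinear_apply, gapAnchor]
  · rw [diffLinear_apply_castSucc, undiffLinear_apply, gapAnchor_castSucc, suffixSum_apply, sum_filter_ge_eq_add]
    -- `J.succ` is either `last` or a `castSucc`
    rcases Fin.eq_castSucc_or_eq_last J.succ with ⟨K, hK⟩ | hlast
    · rw [hK, gapAnchor_castSucc, suffixSum_apply]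
      have hKval : K.val = J.val + 1 := by
        have := congrArg Fin.val hK; simp at this; omega
      have hfilt : Finset.univ.filter (fun a : Fin m => K ≤ a) = Finset.univ.filter (fun a : Fin m => J.val + 1 ≤ a.val) := by
        ext a
        simp only [Finset.mem_filter, Finset.mem_univ, true_and]
        rw [Fin.le_iff_val_le_val, hKval]
      rw [hfilt]
      ring
    · have hJ : J.val + 1 = m := by
        have := congrArg Fin.val hlast; simp at this; omega
      rw [hlast, gapAnchor_last]
      have hempty : Finset.univ.filter (fun a : Fin m => J.val + 1 ≤ a.val) = ∅ := by
        ext a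
        simp only [Finset.mem_filter, Finset.mem_univ, true_and, Finset.notMem_empty, iff_false, not_le]
        omega
      rw [hempty, Finset.sum_empty]
      ring

/-- `undiff ∘ diff = id` (a right inverse of an endomorphism of a finite-dimensional space is a left inverse). [folklore] -/
theorem undiffLinear_diffLinear (a : Fin (m + 1) → ℝ) : undiffLinear m (diffLinear m a) = a := by
  have hsurj : Function.Surjective (diffLinear m) := fun d => ⟨undiffLinear m d, diffLinear_undiffLinear m d⟩
  have hinj : Function.Injective (diffLinear m) := LinearMap.injective_iff_surjective.2 hsurj
  exact hinj (diffLinear_undiffLinear m (diffLinear m a))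

/-- **The differences map as a continuous linear equivalence of `ℝ^{m+1}`.** [folklore] -/
def diffEquiv : (Fin (m + 1) → ℝ) ≃L[ℝ] (Fin (m + 1) → ℝ) :=
  LinearEquiv.toContinuousLinearEquiv
    { diffLinear m with
      invFun := undiffLinear m
      left_inv := undiffLinear_diffLinear m
      right_inv := diffLinear_undiffLinear m }

/-- Values of the differences equivalence: consecutive gaps. [folklore] -/
@[simp] theorem diffEquiv_apply_castSucc (a : Fin (m + 1) → ℝ) (J : Fin m) :
    diffEquiv m a J.castSucc = a J.succ - a J.castSucc := diffLinear_apply_castSucc m a J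

/-- Values of the differences equivalence: the anchor. [folklore] -/
@[simp] theorem diffEquiv_apply_last (a : Fin (m + 1) → ℝ) : diffEquiv m a (Fin.last m) = a (Fin.last m) :=
  diffLinear_apply_last m a

/-- The inverse of the differences equivalence is `gapAnchor`. [folklore] -/
theorem diffEquiv_symm_apply (d : Fin (m + 1) → ℝ) :
    (diffEquiv m).symm d = gapAnchor m (d (Fin.last m), fun J => d J.castSucc) := rfl

/-- `diffEquiv (gapAnchor (t, g)) = snoc g t`: the differences of the anchored configuration are the gaps. [folklore] -/
theorem diffEquiv_gapAnchor (z : ℝ × (Fin m → ℝ)) : diffEquiv m (gapAnchor m z) = Fin.snoc z.2 z.1 := by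
  have h : gapAnchor m z = (diffEquiv m).symm (Fin.snoc z.2 z.1) := by
    rw [diffEquiv_symm_apply]
    simp
  rw [h, ContinuousLinearEquiv.apply_symm_apply]

end Literature.Analysis.Matrix
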